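import Summits.CriticalPhenomena.PercolationContinuityZ3.Theorems.PercNearOneGluingNoHeavyConstsLinearLowerTailFourFree
import Summits.CriticalPhenomena.PercolationContinuityZ3.Theorems.PercNearOneGluingNoHeavyConstsLinearLowerTailFive
import Summits.CriticalPhenomena.PercolationContinuityZ3.Theorems.PercNearOneGluingNoHeavyConstsFootprintTransfer
import HarnessLib

/-!
# (LT³⁄₂) for an arbitrary observer: every instance with `|A| ≤ 6`, and every instance with `κ·|A| ≤ 4`

builds on p205010 (kernel theorem, internal audit signed; external expert review pending)

PAPER-2 track "percolation constants", part (ii), seat `prim-consts-1` (lane index `run/shared/lean/prim/consts/CONSTANTS.md`,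
row A19, §4 N26/N27).  Support file for the crux `NoHeavyLowerTail` (stmt-CriticalPhenomena-4575; `--supports`): theorems only.

The conjecture `Consts.LinearLowerTailThreeHalves`: for `0 < κ ≤ 2/3`, every finite weighted graph, relay set `A`, observer `o` and
`s ≥ max P(a ↮ a')`, `P(1 ≤ N < κ·EN) ≤ (3/2)·s` (`N = |C(o) ∩ A|`, `EN = Σ_a P(o ↔ a)`).  The cases with the observer INSIDE `A`
and `|A| ≤ 6` (or `κ|A| ≤ 4`) are `…ConstsLinearLowerTailFive/Six`; `|A| ≤ 4` with any observer is `…FourFree`.  This file removes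
the restriction `o ∈ A` from the remaining cases by the FOOTPRINT TRANSFER of `…ConstsFootprintTransfer`
(`Consts.lowerTail_le_blockDeficit`, the tree's gluing inequality (GEN) at the threshold functional): the footprint lower tail of an
arbitrary observer, `μ(1 ≤ N_o < k)`, is at most `μ(o ↔ A) · max_{a ∈ A} μ(N_a < k)`, where `N_a = |C(a) ∩ A| ∋ a` is the relay
mass of `a`'s own block.  For `|A| ≥ 5` and `k = 4` the block event `{N_a < 4}` says that `a` keeps at most two of the other relay
points, hence loses at least two of any four fixed ones, and the five-point anti-halving lemma
`Consts.real_two_le_lost_le_three_halves` bounds it by `(3/2)·s`.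

* `Consts.real_blockDeficit_four_le_three_halves` — `a ∈ A`, `|A| ≥ 5`, all pairs of `A` `≤ s`-unreliable ⇒ `μ(N_a < 4) ≤ (3/2)·s`.
* `Consts.real_lowerTail_le_three_halves_of_mul_card_le_four_any` — ANY observer, `|A| ≥ 5`, `κ·|A| ≤ 4` ⇒
  `μ(1 ≤ N < κ·EN) ≤ (3/2)·s` (no sign or size condition on `κ` is needed beyond `κ|A| ≤ 4`).
* `Consts.real_lowerTail_le_three_halves_of_card_le_six_any` — ANY observer, `|A| ≤ 6`, `0 < κ ≤ 2/3` ⇒ `μ(1 ≤ N < κ·EN) ≤ (3/2)·s`.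
* `Consts.linearLowerTailThreeHalves_of_card_le_six_any`, `Consts.linearLowerTailThreeHalves_of_mul_card_le_four_any` — the same
  in the conjecture's quantifier shape: (LT³⁄₂) holds for EVERY instance with `|A| ≤ 6`, and for every instance with `κ·|A| ≤ 4`
  (`|A| ≤ 8` at `κ ≤ 1/2`, `|A| ≤ 10` at `κ ≤ 2/5`, …).

Remark (honest bookkeeping).  By the same transfer, the outside-observer case `|A| = 4` of `…FourFree` also follows from the
pointwise bound `μ(N_a ≤ 2) ≤ (3/2)·s` for a relay point among four; the certificate of `…FourFreeCore` is an independent proof of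
that case from relay-side association alone (no gluing input), which is what matters for the barrier analysis of the lane memo.

References: G. Kozma, N. Nitzan, arXiv:2401.12397 (2024), Conjecture 1 (p. 3), Conjecture 4 (p. 32); J. van den Berg,
O. Häggström, J. Kahn, Random Structures Algorithms 29 (2006) 417–435, Thm. 1.3 (p. 6).
-/

noncomputable section

namespace Summit.CriticalPhenomena.PercolationContinuityZ3.Theorems

open MeasureTheory Set Literature.Probability.LatticeModels Literature.Probability.Percolation
open scoped Classical

namespace Consts

/-- **Block deficit of a relay point in a pairwise-reliable set of size ≥ 5.**  If `a ∈ A`, `|A| ≥ 5` and every pair of `A` is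
cut with probability `≤ s`, then `μ(N_a < 4) ≤ (3/2)·s`, where `N_a = |{b ∈ A : a ↔ b}|` (counting `a`).  Indeed `N_a < 4` means
that `a` keeps at most two other relay points, so it loses at least two of any four fixed other ones, and the five-point lemma
`Consts.real_two_le_lost_le_three_halves` applies. [cite: VandenbergHaggstromKahn2005, Thm. 1.3 (p. 6)] -/
theorem real_blockDeficit_four_le_three_halves (n : ℕ) (w : Sym2 (Fin n) → unitInterval) (A : Finset (Fin n)) (a : Fin n)
    (ha : a ∈ A) (hA : 5 ≤ A.card) {s : ℝ} (hrel : ∀ b ∈ A, ∀ b' ∈ A, (prodBernoulli w).real (openConn b b')ᶜ ≤ s) :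
    (prodBernoulli w).real {ω : BondConfig (Fin n) | (A.filter fun b => ω ∈ openConn a b).card < 4} ≤ 3 / 2 * s := by
  set μ := prodBernoulli w with hμ
  -- four relay points other than `a`
  have hB4 : 4 ≤ (A.erase a).card := by rw [Finset.card_erase_of_mem ha]; omega
  obtain ⟨C, hCB, hCcard⟩ := Finset.exists_subset_card_eq hB4
  set ε := C.equivFinOfCardEq hCcard with hε
  set x : Fin 4 → Fin n := fun k => ((ε.symm k : C) : Fin n) with hx
  have hxC : ∀ k, x k ∈ C := fun k => (ε.symm k).2
  have hxa : ∀ k, x k ≠ a := fun k => (Finset.mem_erase.1 (hCB (hxC k))).1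
  have hxA : ∀ k, x k ∈ A := fun k => (Finset.mem_erase.1 (hCB (hxC k))).2
  have hxinj : Function.Injective x := by
    intro k k' hkk'
    have : ε.symm k = ε.symm k' := Subtype.ext hkk'
    exact ε.symm.injective this
  have hCmap : C = Finset.univ.map ⟨x, hxinj⟩ := by
    ext b
    simp only [Finset.mem_map, Finset.mem_univ, Function.Embedding.coeFn_mk, true_and]
    constructor
    · intro hb
      exact ⟨ε ⟨b, hb⟩, by simp [hx]⟩
    · rintro ⟨k, rfl⟩
      exact hxC k
  have hso : ∀ k, μ.real (openConn a (x k))ᶜ ≤ s := fun k => hrel a ha (x k) (hxA k)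
  have hss : ∀ k k', μ.real (openConn (x k) (x k'))ᶜ ≤ s := fun k k' => hrel (x k) (hxA k) (x k') (hxA k')
  refine le_trans (measureReal_mono ?_) (real_two_le_lost_le_three_halves n w a x hxa hso hss)
  intro ω hω
  simp only [mem_setOf_eq] at hω ⊢
  -- `a` and the kept points of `C` are joined to `a` within `A`
  have hsub : insert a (C.filter fun b => ω ∈ openConn a b) ⊆ A.filter fun b => ω ∈ openConn a b := by
    intro b hb
    rcases Finset.mem_insert.1 hb with rfl | hb
    · exact Finset.mem_filter.2 ⟨ha, SimpleGraph.Reachable.refl _⟩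
    · exact Finset.mem_filter.2 ⟨(Finset.mem_erase.1 (hCB (Finset.mem_filter.1 hb).1)).2, (Finset.mem_filter.1 hb).2⟩
  have haC : a ∉ C.filter fun b => ω ∈ openConn a b := fun h =>
    (Finset.mem_erase.1 (hCB (Finset.mem_filter.1 h).1)).1 rfl
  have hcard := Finset.card_le_card hsub
  rw [Finset.card_insert_of_notMem haC] at hcard
  have hkept : (C.filter fun b => ω ∈ openConn a b).card =
      (Finset.univ.filter fun k : Fin 4 => ω ∈ openConn a (x k)).card := by
    rw [hCmap, Finset.filter_map, Finset.card_map]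
    rfl
  have hsplit := Finset.card_filter_add_card_filter_not (s := (Finset.univ : Finset (Fin 4)))
    (fun k : Fin 4 => ω ∈ openConn a (x k))
  rw [Finset.card_univ, Fintype.card_fin] at hsplit
  omega

/-- **(LT³⁄₂) for an ARBITRARY observer whenever `|A| ≥ 5` and `κ·|A| ≤ 4`** (all finite weighted graphs, all `s`):
`P(1 ≤ N < κ·EN) ≤ (3/2)·s`.  The bad event forces `1 ≤ N < 4` (as `κ·EN ≤ κ|A| ≤ 4`); the footprint transfer
`Consts.lowerTail_le_blockDeficit` bounds `μ(1 ≤ N < 4)` by `μ(o ↔ A)·max_a μ(N_a < 4)`, and each block deficit is `≤ (3/2)·s` by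
`Consts.real_blockDeficit_four_le_three_halves`.  Extends `Consts.real_lowerTail_le_three_halves_of_mul_card_le_four` (`o ∈ A`).
[cite: KozmaNitzan2024, Conj. 1 (p. 3)] -/
theorem real_lowerTail_le_three_halves_of_mul_card_le_four_any (n : ℕ) (w : Sym2 (Fin n) → unitInterval) (A : Finset (Fin n))
    (o : Fin n) (hA : 5 ≤ A.card) {κ s : ℝ} (hκA : κ * A.card ≤ 4)
    (hrel : ∀ a ∈ A, ∀ a' ∈ A, (prodBernoulli w).real (openConn a a')ᶜ ≤ s) :
    (prodBernoulli w).real {ω : BondConfig (Fin n) | 1 ≤ (A.filter fun a => ω ∈ openConn o a).card ∧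
        ((A.filter fun a => ω ∈ openConn o a).card : ℝ) < κ * (∑ a ∈ A, (prodBernoulli w).real (openConn o a))} ≤
      3 / 2 * s := by
  set μ := prodBernoulli w with hμ
  -- `s ≥ 0` (from a diagonal pair of the nonempty relay set)
  have hAne : A.Nonempty := Finset.card_pos.1 (by omega)
  obtain ⟨a₀, ha₀⟩ := hAne
  have hs : 0 ≤ s := le_trans measureReal_nonneg (hrel a₀ ha₀ a₀ ha₀)
  -- footprint transfer at `k = 4`
  have hblk : ∀ a ∈ A, μ.real {ω : BondConfig (Fin n) | (A.filter fun b => ω ∈ openConn a b).card < 4} ≤ 3 / 2 * s :=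
    fun a ha => real_blockDeficit_four_le_three_halves n w A a ha hA hrel
  have htr := lowerTail_le_blockDeficit n w A o 4 (3 / 2 * s) hblk
  have hU1 : μ.real (⋃ a ∈ A, openConn o a) ≤ 1 := measureReal_le_one
  have h32 : 3 / 2 * s * μ.real (⋃ a ∈ A, openConn o a) ≤ 3 / 2 * s := by
    have h0 : 0 ≤ 3 / 2 * s := by linarith
    nlinarith [measureReal_nonneg (μ := μ) (s := ⋃ a ∈ A, openConn o a)]
  refine le_trans (measureReal_mono ?_) (htr.trans h32)
  intro ω hω
  simp only [mem_setOf_eq] at hω ⊢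
  obtain ⟨h1, hlt⟩ := hω
  refine ⟨h1, ?_⟩
  have hEN : (∑ a ∈ A, μ.real (openConn o a)) ≤ A.card := by
    calc (∑ a ∈ A, μ.real (openConn o a)) ≤ ∑ a ∈ A, (1 : ℝ) := Finset.sum_le_sum fun a _ => measureReal_le_one
      _ = A.card := by simp
  have hEN0 : (0 : ℝ) ≤ ∑ a ∈ A, μ.real (openConn o a) := Finset.sum_nonneg fun a _ => measureReal_nonneg
  have h4 : κ * (∑ a ∈ A, μ.real (openConn o a)) ≤ 4 := by
    by_cases hk : 0 ≤ κ
    · calc κ * (∑ a ∈ A, μ.real (openConn o a)) ≤ κ * A.card := mul_le_mul_of_nonneg_left hEN hk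
        _ ≤ 4 := hκA
    · have : κ * (∑ a ∈ A, μ.real (openConn o a)) ≤ 0 :=
        mul_nonpos_of_nonpos_of_nonneg (le_of_lt (lt_of_not_ge hk)) hEN0
      linarith
  have : ((A.filter fun a => ω ∈ openConn o a).card : ℝ) < 4 := lt_of_lt_of_le hlt h4
  exact_mod_cast this

/-- **(LT³⁄₂) for `|A| ≤ 6`, ANY observer, every `0 < κ ≤ 2/3`** (all finite weighted graphs, all `s`): `P(1 ≤ N < κ·EN) ≤ (3/2)·s`.
`|A| ≤ 4` is `Consts.real_lowerTail_le_three_halves_of_card_le_four`; for `|A| ∈ {5, 6}` one has `κ|A| ≤ 4` and the previous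
theorem applies. [cite: KozmaNitzan2024, Conj. 1 (p. 3)] -/
theorem real_lowerTail_le_three_halves_of_card_le_six_any (n : ℕ) (w : Sym2 (Fin n) → unitInterval) (A : Finset (Fin n))
    (o : Fin n) (hA : A.card ≤ 6) {κ s : ℝ} (hκ0 : 0 < κ) (hκ : κ ≤ 2 / 3) (hs : 0 ≤ s)
    (hrel : ∀ a ∈ A, ∀ a' ∈ A, (prodBernoulli w).real (openConn a a')ᶜ ≤ s) :
    (prodBernoulli w).real {ω : BondConfig (Fin n) | 1 ≤ (A.filter fun a => ω ∈ openConn o a).card ∧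
        ((A.filter fun a => ω ∈ openConn o a).card : ℝ) < κ * (∑ a ∈ A, (prodBernoulli w).real (openConn o a))} ≤
      3 / 2 * s := by
  by_cases h4 : A.card ≤ 4
  · exact real_lowerTail_le_three_halves_of_card_le_four n w A o h4 hκ0 hκ hs hrel
  · have h5 : 5 ≤ A.card := by omega
    have hκA : κ * A.card ≤ 4 := by
      have h6 : (A.card : ℝ) ≤ 6 := by exact_mod_cast hA
      have hM0 : (0 : ℝ) ≤ A.card := Nat.cast_nonneg _
      nlinarith
    exact real_lowerTail_le_three_halves_of_mul_card_le_four_any n w A o h5 hκA hrel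

/-- **(LT³⁄₂) for every instance with `|A| ≤ 6`** in the conjecture's quantifier shape (`Consts.LinearLowerTailThreeHalves`
restricted to `|A| ≤ 6`; any observer). [cite: KozmaNitzan2024, Conj. 1 (p. 3)] -/
theorem linearLowerTailThreeHalves_of_card_le_six_any :
    ∀ κ : ℝ, 0 < κ → κ ≤ 2 / 3 →
      ∀ (n : ℕ) (w : Sym2 (Fin n) → unitInterval) (A : Finset (Fin n)) (o : Fin n) (s : ℝ), 0 ≤ s →
        A.card ≤ 6 →
        (∀ a ∈ A, ∀ a' ∈ A, (prodBernoulli w).real (openConn a a')ᶜ ≤ s) →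
        (prodBernoulli w).real {ω : BondConfig (Fin n) | 1 ≤ (A.filter fun a => ω ∈ openConn o a).card ∧
            ((A.filter fun a => ω ∈ openConn o a).card : ℝ) < κ * (∑ a ∈ A, (prodBernoulli w).real (openConn o a))} ≤
          3 / 2 * s :=
  fun _ hκ0 hκ n w A o _ hs hA hrel => real_lowerTail_le_three_halves_of_card_le_six_any n w A o hA hκ0 hκ hs hrel

/-- **(LT³⁄₂) for every instance with `κ·|A| ≤ 4`** in the conjecture's quantifier shape (any observer; `|A| ≤ 6` at `κ = 2/3`,
`|A| ≤ 8` at `κ ≤ 1/2`, `|A| ≤ 10` at `κ ≤ 2/5`). [cite: KozmaNitzan2024, Conj. 1 (p. 3)] -/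
theorem linearLowerTailThreeHalves_of_mul_card_le_four_any :
    ∀ κ : ℝ, 0 < κ → κ ≤ 2 / 3 →
      ∀ (n : ℕ) (w : Sym2 (Fin n) → unitInterval) (A : Finset (Fin n)) (o : Fin n) (s : ℝ), 0 ≤ s →
        κ * A.card ≤ 4 →
        (∀ a ∈ A, ∀ a' ∈ A, (prodBernoulli w).real (openConn a a')ᶜ ≤ s) →
        (prodBernoulli w).real {ω : BondConfig (Fin n) | 1 ≤ (A.filter fun a => ω ∈ openConn o a).card ∧
            ((A.filter fun a => ω ∈ openConn o a).card : ℝ) < κ * (∑ a ∈ A, (prodBernoulli w).real (openConn o a))} ≤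
          3 / 2 * s := by
  intro κ hκ0 hκ n w A o s hs hκA hrel
  by_cases h4 : A.card ≤ 4
  · exact real_lowerTail_le_three_halves_of_card_le_four n w A o h4 hκ0 hκ hs hrel
  · exact real_lowerTail_le_three_halves_of_mul_card_le_four_any n w A o (by omega) hκA hrel

end Consts

end Summit.CriticalPhenomena.PercolationContinuityZ3.Theorems
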